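import Literature.AlgebraicGeometry.HodgeTheory.GAGALineBundles
import Literature.AlgebraicGeometry.Modules.UnitCocycle
import HarnessLib

/-!
# GAGA for line bundles: the algebraic half `Pic X = CaCl X` (proved) and the reduction to Serre's Prop. 18

Family `hodge`, layer `Literature/AlgebraicGeometry/HodgeTheory`. Proof file under the named fact
`serreGAGA_lineCocycle_iso_cartierDivisorCocycle` (`GAGALineBundles.lean`): for `X` smooth projective
over `ℂ` with Hodge model `A`, every holomorphic rank-one cocycle `V` on `A.carrier ≅ X^an` is
holomorphically isomorphic to `𝒪_X(D)^an = cartierDivisorCocycle A.isAnalytification D` for some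
Cartier divisor `D` on `X`. As its docstring says, the fact is the conjunction of TWO printed results:

1. J.-P. Serre, GAGA (1956), n° 20 Prop. 18 («Si `G` est le groupe linéaire général `GL_r(C)`,
   l'application `ε : H¹(X, 𝒢) → H¹(X^h, 𝒢^h)` est bijective», `X` projective), for `r = 1` and the
   surjectivity only: every holomorphic line bundle on `X^h` is analytically isomorphic to `E^h` for an
   ALGEBRAIC line bundle `E` on `X`, i.e. (FAC n° 41 / Görtz–Wedhorn I Prop. 11.15) for a Čech
   `1`-cocycle of units `g_{xy} ∈ Γ(U_x ∩ U_y, 𝒪_X^×)` on a Zariski cover — in the tree the structure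
   `Literature.AlgebraicGeometry.Modules.UnitCocycle X` (point-indexed covers, `Modules/UnitCocycle`),
   whose analytification `E^h` (§4 n° 20: «tout espace fibré algébrique `E` définit un espace fibré
   analytique `E^h`», transition functions `g_{xy}` read on `X^h`) is the holomorphic cocycle
   `UnitCocycle.analytification` below;
2. Görtz–Wedhorn I, Prop. 11.21 (p. 374): for `X` integral, `D ↦ 𝒪_X(D)` induces
   `DivCl(X) ≅ Pic(X)` — here the surjectivity: every unit cocycle on the integral `X` IS the cocycle
   `f_x / f_y` of a Cartier divisor (`UnitCocycle.toCartierDivisor`: `f_x := g_{x ξ} ∈ K(X)^×`, `ξ` the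
   generic point; Hartshorne II.6.15, proof of Prop. 11.29 in Görtz–Wedhorn).

This file PROVES (2) in the tree's vocabulary and the glue, so that what remains of the named fact
is exactly (1):

* `UnitCocycle.analytification hφ c` — the holomorphic rank-one cocycle `E^h` on an analytification
  `φ : M → X(ℂ)` (`analytification_isHolomorphic`, Serre §2 n° 6: regular functions are holomorphic);
* `UnitCocycle.toCartierDivisor c` and `UnitCocycle.transFun_toCartierDivisor` — **`Pic X → CaCl X`
  for `X` integral**: the Cartier divisor `(U_x, g_{x ξ})` has the cocycle `g_{xy}` on the nose;
* `UnitCocycle.analyticallyEquivalent_cartierDivisorCocycle` — hence `E^h` is holomorphically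
  isomorphic to `𝒪_X(D)^an` for `D = c.toCartierDivisor`;
* `serreGAGA_lineCocycle_iso_cartierDivisorCocycle_of_prop18` — **the named fact follows from Serre's
  Prop. 18 (`r = 1`, surjectivity) alone**, the latter spelled inline as the hypothesis `h18`
  (no new named fact, D-0026).

## What is NOT here

The proof of Prop. 18 itself. Printed, it is Théorème 3 of GAGA (every coherent analytic sheaf on
`X^h` is algebraisable: Cartan's Theorems A and B, the finiteness theorem, Théorèmes 1–2) applied to
a locally free `𝓗`-module of rank one plus Prop. 30 of the Annexe; for `X` non-singular it is the
theorem of Kodaira–Spencer (Remarque 1, p. 32: existence of a non-zero meromorphic section of every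
holomorphic line bundle on a projective manifold — sections of `L ⊗ 𝒪(N)`, `N ≫ 0` — followed by
Chow's theorem, which the tree has as `chow_analyticSet_analytification_holds`). Neither the
coherent-analytic cohomology of projective space nor the Kodaira–Serre existence of sections of
twists of an arbitrary holomorphic line bundle is in the tree at the time of writing.

## References

* J.-P. Serre, *Géométrie algébrique et géométrie analytique*, Ann. Inst. Fourier 6 (1956): §2 n° 6,
  §4 n° 20 Prop. 18 and Remarque 1 (pp. 31–32). [SerreGAGA1956]
* U. Görtz, T. Wedhorn, *Algebraic Geometry I: Schemes*, 2nd ed. (2020): (11.9) Def. 11.20,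
  Prop. 11.21 (p. 374), Prop. 11.29. [GortzWedhorn2020]
* R. Hartshorne, *Algebraic Geometry* (1977), II Prop. 6.15, III Ex. 4.5. [Hartshorne1977]
-/

noncomputable section

open scoped Manifold ContDiff
open CategoryTheory AlgebraicGeometry TopologicalSpace Opposite
open Literature.AlgebraicGeometry.Motives
open Literature.AlgebraicGeometry.Motives.RatFn
open Literature.AlgebraicGeometry.Motives.AlgPoints
open Literature.AlgebraicGeometry.Modules
open Literature.NumberTheory.Transcendental
open Literature.Geometry.Kaehler
open Literature.Geometry.Kaehler.SmoothComplexVectorBundle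

namespace Literature.AlgebraicGeometry.HodgeTheory

/-! ### `Pic X → CaCl X` for `X` integral: a unit cocycle is the cocycle of a Cartier divisor -/

section ToCartierDivisor

universe u

variable {Y : Scheme.{u}}

/-- The transition function `g_{xy}` of a unit cocycle over the full overlap `U_x ∩ U_y`. [folklore] -/
abbrev _root_.Literature.AlgebraicGeometry.Modules.UnitCocycle.gInf (c : UnitCocycle Y) (x y : Y) :
    Γ(Y, c.U x ⊓ c.U y) :=
  c.g x y (c.U x ⊓ c.U y) inf_le_left inf_le_right

variable [IsIntegral Y] (c : UnitCocycle Y)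

/-- The open `U_x ∩ U_ξ` (`ξ` the generic point) over which the local equation `f_x = g_{x ξ}` is
read off. [folklore] -/
abbrev _root_.Literature.AlgebraicGeometry.Modules.UnitCocycle.genOpen (x : Y) : Y.Opens :=
  c.U x ⊓ c.U (genericPoint Y)

/-- The generic point lies in `U_x ∩ U_ξ` (every `U_x ∋ x` is a non-empty open of the irreducible
`Y`). [folklore] -/
theorem _root_.Literature.AlgebraicGeometry.Modules.UnitCocycle.genericPoint_mem_genOpen (x : Y) :
    genericPoint Y ∈ c.genOpen x :=
  ⟨genericPoint_mem_of_mem (c.mem x), c.mem _⟩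

/-- The local equation `f_x := g_{x ξ} ∈ K(Y)` (the rational function of the unit section `g_{x ξ}`
over `U_x ∩ U_ξ`; Görtz–Wedhorn I, proof of Prop. 11.29 / Hartshorne II.6.15: on an integral scheme
every invertible sheaf is a subsheaf of `𝒦_X`). [cite: GortzWedhorn2020, Prop. 11.21 (p. 374)] -/
def _root_.Literature.AlgebraicGeometry.Modules.UnitCocycle.ratFn (x : Y) : Y.functionField :=
  ofSection (c.genericPoint_mem_genOpen x) (c.gInf x (genericPoint Y))

/-- The generic point lies in every `U_x ∩ U_y`. [folklore] -/
theorem _root_.Literature.AlgebraicGeometry.Modules.UnitCocycle.genericPoint_mem_inf (x y : Y) :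
    genericPoint Y ∈ c.U x ⊓ c.U y :=
  ⟨genericPoint_mem_of_mem (c.mem x), genericPoint_mem_of_mem (c.mem y)⟩

/-- The rational function of `g_{xy}` over any open `V ∋ ξ` below `U_x ∩ U_y` is the one over
`U_x ∩ U_y` (compatibility of the cocycle with restriction). [folklore] -/
theorem _root_.Literature.AlgebraicGeometry.Modules.UnitCocycle.ofSection_g (x y : Y) {V : Y.Opens}
    (hx : V ≤ c.U x) (hy : V ≤ c.U y) (hV : genericPoint Y ∈ V) :
    ofSection hV (c.g x y V hx hy) = ofSection (c.genericPoint_mem_inf x y) (c.gInf x y) := by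
  rw [← c.map_g x y inf_le_left inf_le_right (le_inf hx hy : V ≤ c.U x ⊓ c.U y)]
  exact ofSection_map (homOfLE (le_inf hx hy)) hV _

/-- `f_x ≠ 0` (it is the image of a unit section). [folklore] -/
theorem _root_.Literature.AlgebraicGeometry.Modules.UnitCocycle.ratFn_ne_zero (x : Y) : c.ratFn x ≠ 0 :=
  ((c.isUnit_g x (genericPoint Y) _ inf_le_left inf_le_right).map _).ne_zero

/-- **The cocycle is the coboundary of the local equations in `K(Y)`**: `f_x / f_y = g_{xy}` as
rational functions (`g_{xξ} = g_{xy} g_{yξ}` at the generic point). [cite: GortzWedhorn2020, Prop. 11.21 (p. 374)] -/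
theorem _root_.Literature.AlgebraicGeometry.Modules.UnitCocycle.ratFn_div_ratFn (x y : Y) :
    c.ratFn x / c.ratFn y = ofSection (c.genericPoint_mem_inf x y) (c.gInf x y) := by
  set ξ := genericPoint Y
  set W : Y.Opens := c.U x ⊓ c.U y ⊓ c.U ξ with hW
  have hWx : W ≤ c.U x := inf_le_left.trans inf_le_left
  have hWy : W ≤ c.U y := inf_le_left.trans inf_le_right
  have hWξ : W ≤ c.U ξ := inf_le_right
  have hξW : ξ ∈ W := ⟨c.genericPoint_mem_inf x y, c.mem ξ⟩
  have hx : c.ratFn x = ofSection hξW (c.g x ξ W hWx hWξ) := by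
    rw [UnitCocycle.ratFn, c.ofSection_g x ξ hWx hWξ hξW]
  have hy : c.ratFn y = ofSection hξW (c.g y ξ W hWy hWξ) := by
    rw [UnitCocycle.ratFn, c.ofSection_g y ξ hWy hWξ hξW]
  have hy0 : ofSection hξW (c.g y ξ W hWy hWξ) ≠ 0 := hy ▸ c.ratFn_ne_zero y
  rw [hx, hy, ← c.ofSection_g x y hWx hWy hξW, div_eq_iff hy0, ← map_mul, c.g_mul x y ξ W hWx hWy hWξ]

/-- **`Pic Y → CaCl Y` (Görtz–Wedhorn I, Prop. 11.21; Hartshorne II.6.15): the Cartier divisor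
`(U_x, f_x = g_{x ξ})` of a unit cocycle on an integral scheme** — `f_x / f_y = g_{xy}` is a unit on
`U_x ∩ U_y`. Its line bundle `𝒪_Y(D)` has the cocycle `g_{xy}` on the nose
(`transFun_toCartierDivisor`). [cite: GortzWedhorn2020, Prop. 11.21 (p. 374)]
[cite: Hartshorne1977, II Prop. 6.15] -/
def _root_.Literature.AlgebraicGeometry.Modules.UnitCocycle.toCartierDivisor : CartierDivisor Y where
  ι := Y
  U := c.U
  covers x := ⟨x, c.mem x⟩
  f := c.ratFn
  f_ne_zero := c.ratFn_ne_zero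
  isUnitAt_div x y z hzx hzy := by
    rw [c.ratFn_div_ratFn x y]
    exact isUnitAt_ofSection_of_isUnit (c.isUnit_g x y _ inf_le_left inf_le_right)
      (show z ∈ c.U x ⊓ c.U y from ⟨hzx, hzy⟩)

/-- The charts of `c.toCartierDivisor` are the `U_x` (definitional). [folklore] -/
@[simp]
theorem _root_.Literature.AlgebraicGeometry.Modules.UnitCocycle.toCartierDivisor_U (x : Y) :
    c.toCartierDivisor.U x = c.U x :=
  rfl

/-- The local equations of `c.toCartierDivisor` are the `f_x = g_{xξ}` (definitional). [folklore] -/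
@[simp]
theorem _root_.Literature.AlgebraicGeometry.Modules.UnitCocycle.toCartierDivisor_f (x : Y) :
    c.toCartierDivisor.f x = c.ratFn x :=
  rfl

/-- **`𝒪_Y(D)` for `D = c.toCartierDivisor` has the cocycle `g_{xy}` on the nose**: the transition
function `f_x / f_y ∈ Γ(U_x ∩ U_y, 𝒪_Y)` of `Motives/CartierDivisorCocycle` IS `g_{xy}` (sections over
an open of an integral scheme are determined by their rational functions).
[cite: GortzWedhorn2020, Prop. 11.21 (p. 374) and Rem. 11.16 (p. 369)] -/
theorem _root_.Literature.AlgebraicGeometry.Modules.UnitCocycle.transFun_toCartierDivisor (x y : Y) :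
    c.toCartierDivisor.transFun x y = c.gInf x y :=
  section_ext fun h ↦ by rw [CartierDivisor.ofSection_transFun]; exact c.ratFn_div_ratFn x y

/-! ### Conversely: the unit cocycle of a Cartier divisor (`CaCl X → Pic X`) -/

/-- A chart index `i(x)` with `x ∈ U_{i(x)}`. [folklore] -/
def _root_.Literature.AlgebraicGeometry.Motives.CartierDivisor.chartIdx (D : CartierDivisor Y) (x : Y) : D.ι :=
  (D.covers x).choose

/-- `x ∈ U_{i(x)}`. [folklore] -/
theorem _root_.Literature.AlgebraicGeometry.Motives.CartierDivisor.mem_U_chartIdx (D : CartierDivisor Y) (x : Y) :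
    x ∈ D.U (D.chartIdx x) :=
  (D.covers x).choose_spec

/-- **The unit cocycle `g_{xy} = f_{i(x)} / f_{i(y)}` of `𝒪_Y(D)` on the point-indexed cover
`x ↦ U_{i(x)}`** (Görtz–Wedhorn I, (11.9) and Rem. 11.16: the class of `𝒪_Y(D)` in `Ȟ¹(Y, 𝒪_Y^×)`;
the map `Div(Y) → Pic(Y)` of Prop. 11.21), with the transition functions
`CartierDivisor.transFun` restricted to the opens below `U_{i(x)} ∩ U_{i(y)}`.
[cite: GortzWedhorn2020, Prop. 11.21 (p. 374) and Rem. 11.16 (p. 369)] -/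
def _root_.Literature.AlgebraicGeometry.Motives.CartierDivisor.toUnitCocycle (D : CartierDivisor Y) :
    UnitCocycle Y where
  U x := D.U (D.chartIdx x)
  mem := D.mem_U_chartIdx
  g x y V hx hy := Y.presheaf.map (homOfLE (le_inf hx hy : V ≤ D.U (D.chartIdx x) ⊓ D.U (D.chartIdx y))).op
    (D.transFun (D.chartIdx x) (D.chartIdx y))
  map_g x y V V' hx hy i := res_res _ _ _
  g_mul x y z V hx hy hz := by
    refine section_ext fun hV ↦ ?_
    simp only [map_mul, ofSection_map, CartierDivisor.ofSection_transFun]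
    exact div_mul_div_cancel₀ (D.f_ne_zero _)
  g_self x V hx := by rw [D.transFun_self, map_one]

/-- The cover of `D.toUnitCocycle` (definitional). [folklore] -/
@[simp]
theorem _root_.Literature.AlgebraicGeometry.Motives.CartierDivisor.toUnitCocycle_U (D : CartierDivisor Y) (x : Y) :
    D.toUnitCocycle.U x = D.U (D.chartIdx x) :=
  rfl

/-- The transition functions of `D.toUnitCocycle` over the full overlaps are restrictions (along the
identity) of the `transFun`. [folklore] -/
theorem _root_.Literature.AlgebraicGeometry.Motives.CartierDivisor.toUnitCocycle_gInf (D : CartierDivisor Y) (x y : Y) :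
    D.toUnitCocycle.gInf x y =
      Y.presheaf.map (homOfLE (le_refl (D.U (D.chartIdx x) ⊓ D.U (D.chartIdx y)))).op (D.transFun (D.chartIdx x) (D.chartIdx y)) :=
  rfl

end ToCartierDivisor

/-! ### The analytification `E^h` of an algebraic line bundle given by a unit cocycle -/

section Analytification

variable {X : SchemeOver ℂ} {n : ℕ}
  {E : Type*} [NormedAddCommGroup E] [NormedSpace ℂ E] [FiniteDimensional ℂ E]
  {M : Type*} [TopologicalSpace M] [ChartedSpace E M] [IsManifold 𝓘(ℂ, E) ω M]
  [IsManifold 𝓘(ℝ, E) ∞ M]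
  {φ : M → ComplexPoints X} (hφ : IsAnalytification E X n φ) (c : UnitCocycle X.left)

/-- `g_{xy}(P) g_{yz}(P) = g_{xz}(P)` at a complex point of `U_x ∩ U_y ∩ U_z`. [folklore] -/
theorem _root_.Literature.AlgebraicGeometry.Modules.UnitCocycle.evalOrZero_gInf_mul (c : UnitCocycle X.left)
    {x y z : X.left} {P : ComplexPoints X} (hx : P.pt ∈ c.U x) (hy : P.pt ∈ c.U y) (hz : P.pt ∈ c.U z) :
    evalOrZero (c.U x ⊓ c.U y) (c.gInf x y) P * evalOrZero (c.U y ⊓ c.U z) (c.gInf y z) P =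
      evalOrZero (c.U x ⊓ c.U z) (c.gInf x z) P := by
  set W : X.left.Opens := c.U x ⊓ c.U y ⊓ c.U z with hW
  have hP : P.pt ∈ W := ⟨⟨hx, hy⟩, hz⟩
  have hWx : W ≤ c.U x := inf_le_left.trans inf_le_left
  have hWy : W ≤ c.U y := inf_le_left.trans inf_le_right
  have hWz : W ≤ c.U z := inf_le_right
  have hmul := c.g_mul x y z W hWx hWy hWz
  -- restrict the three `gInf` to `W`
  have ex : X.left.presheaf.map (homOfLE (inf_le_left : W ≤ c.U x ⊓ c.U y)).op (c.gInf x y) = c.g x y W hWx hWy :=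
    c.map_g x y inf_le_left inf_le_right inf_le_left
  have ey : X.left.presheaf.map (homOfLE (le_inf hWy hWz : W ≤ c.U y ⊓ c.U z)).op (c.gInf y z) = c.g y z W hWy hWz :=
    c.map_g y z inf_le_left inf_le_right (le_inf hWy hWz)
  have ez : X.left.presheaf.map (homOfLE (le_inf hWx hWz : W ≤ c.U x ⊓ c.U z)).op (c.gInf x z) = c.g x z W hWx hWz :=
    c.map_g x z inf_le_left inf_le_right (le_inf hWx hWz)
  rw [← evalOrZero_map_homOfLE (inf_le_left : W ≤ c.U x ⊓ c.U y) _ hP,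
    ← evalOrZero_map_homOfLE (le_inf hWy hWz : W ≤ c.U y ⊓ c.U z) _ hP,
    ← evalOrZero_map_homOfLE (le_inf hWx hWz : W ≤ c.U x ⊓ c.U z) _ hP, ex, ey, ez, ← hmul,
    evalOrZero_mul_apply]

/-- `g_{xx}(P) = 1` at a complex point of `U_x`. [folklore] -/
theorem _root_.Literature.AlgebraicGeometry.Modules.UnitCocycle.evalOrZero_gInf_self (c : UnitCocycle X.left)
    {x : X.left} {P : ComplexPoints X} (hx : P.pt ∈ c.U x) :
    evalOrZero (c.U x ⊓ c.U x) (c.gInf x x) P = 1 := by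
  rw [UnitCocycle.gInf, c.g_self, evalOrZero_one (show P.pt ∈ c.U x ⊓ c.U x from ⟨hx, hx⟩)]

/-- **The analytification `E^h` of the algebraic line bundle of a unit cocycle** on an analytification
`φ : M → X(ℂ)`, as a rank-one cocycle: trivialising opens `φ⁻¹(U_x(ℂ))`, transition functions the
`1 × 1` matrices `(g_{xy}(φ m))` — regular, hence holomorphic on `φ⁻¹((U_x ∩ U_y)(ℂ))` (Serre §2 n° 6),
hence real-`C^∞`. Serre §4 n° 20: «tout espace fibré algébrique `E` définit un espace fibré analytique
`E^h`». [cite: SerreGAGA1956, §2 n°6 and §4 n°20] -/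
def _root_.Literature.AlgebraicGeometry.Modules.UnitCocycle.analytification :
    SmoothComplexVectorBundle X.left E M 1 where
  baseSet x := φ ⁻¹' {P | P.pt ∈ c.U x}
  isOpen_baseSet x := hφ.isOpen_preimage (c.U x)
  exists_mem_baseSet m := ⟨(φ m).pt, c.mem _⟩
  coordChange x y m := Matrix.of fun _ _ ↦ evalOrZero (c.U x ⊓ c.U y) (c.gInf x y) (φ m)
  contMDiffOn_coordChange x y _ _ :=
    contMDiffOn_real_of_mdifferentiableOn_complex
      (IsAnalytification.mdifferentiableOn_evalOrZero_opens_holds hφ (c.U x ⊓ c.U y) (c.gInf x y))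
      (hφ.isOpen_preimage (c.U x ⊓ c.U y))
  coordChange_self x m hm := by
    ext a b
    rw [Matrix.of_apply, c.evalOrZero_gInf_self hm, Matrix.one_apply, if_pos (Subsingleton.elim a b)]
  coordChange_comp x y z m hm := by
    ext a b
    simp only [Matrix.mul_apply, Matrix.of_apply, Fin.sum_univ_one]
    exact c.evalOrZero_gInf_mul hm.1.1 hm.1.2 hm.2

/-- The trivialising sets of `E^h` (definitional). [folklore] -/
@[simp]
theorem _root_.Literature.AlgebraicGeometry.Modules.UnitCocycle.analytification_baseSet (x : X.left) :
    (c.analytification hφ).baseSet x = φ ⁻¹' {P | P.pt ∈ c.U x} :=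
  rfl

/-- The transition functions of `E^h` (definitional): `g_{xy}(φ m)`. [folklore] -/
theorem _root_.Literature.AlgebraicGeometry.Modules.UnitCocycle.analytification_coordChange_apply
    (x y : X.left) (m : M) (a b : Fin 1) :
    (c.analytification hφ).coordChange x y m a b = evalOrZero (c.U x ⊓ c.U y) (c.gInf x y) (φ m) :=
  rfl

/-- **`E^h` is a holomorphic cocycle** (regular functions are holomorphic on an analytification,
Serre §2 n° 6). [cite: SerreGAGA1956, §2 n°6] -/
theorem _root_.Literature.AlgebraicGeometry.Modules.UnitCocycle.analytification_isHolomorphic :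
    (c.analytification hφ).IsHolomorphic := fun x y _ _ ↦
  IsAnalytification.mdifferentiableOn_evalOrZero_opens_holds hφ (c.U x ⊓ c.U y) (c.gInf x y)

end Analytification

end Literature.AlgebraicGeometry.HodgeTheory

/-! ### Cocycles with the same transition functions are holomorphically isomorphic -/

namespace Literature.Geometry.Kaehler.SmoothComplexVectorBundle

variable {ι : Type*} {E : Type*} [NormedAddCommGroup E] [NormedSpace ℂ E]
  {M : Type*} [TopologicalSpace M] [ChartedSpace E M] {r : ℕ}

/-- **Two cocycles on the same cover with the same transition matrices on the overlaps present
isomorphic bundles**: `λ_{a i} = g²_{a i}` (condition (C) is the cocycle identity of `V₂` after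
replacing `g¹_{ij}` by `g²_{ij}`; cf. `CocycleIso.refl`). Values of the transition matrices off the
overlaps are junk, whence equality is only asked there. [folklore] -/
def CocycleIso.ofCoordChangeEq (V₁ V₂ : SmoothComplexVectorBundle ι E M r)
    (hU : ∀ i, V₁.baseSet i = V₂.baseSet i)
    (hg : ∀ i j, ∀ x ∈ V₁.baseSet i ∩ V₁.baseSet j, V₁.coordChange i j x = V₂.coordChange i j x) :
    CocycleIso V₁ V₂ where
  map a i := V₂.coordChange a i
  isUnit_map a i x hx :=
    (Matrix.isUnit_iff_isUnit_det _).2 (Matrix.isUnit_det_of_right_inverse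
      (V₂.coordChange_mul_symm a i hx.2 ((hU i).le hx.1)))
  map_mul_coordChange a b i j x hx := by
    obtain ⟨⟨hi, hj⟩, ha, hb⟩ := hx
    rw [hg i j x ⟨hi, hj⟩, V₂.coordChange_comp a i j x ⟨⟨ha, (hU i).le hi⟩, (hU j).le hj⟩,
      V₂.coordChange_comp a b j x ⟨⟨ha, hb⟩, (hU j).le hj⟩]

/-- The matrices of `CocycleIso.ofCoordChangeEq` (definitional). [folklore] -/
@[simp]
theorem CocycleIso.ofCoordChangeEq_map (V₁ V₂ : SmoothComplexVectorBundle ι E M r)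
    (hU : ∀ i, V₁.baseSet i = V₂.baseSet i)
    (hg : ∀ i j, ∀ x ∈ V₁.baseSet i ∩ V₁.baseSet j, V₁.coordChange i j x = V₂.coordChange i j x)
    (a i : ι) : (CocycleIso.ofCoordChangeEq V₁ V₂ hU hg).map a i = V₂.coordChange a i :=
  rfl

/-- If the target cocycle is holomorphic, `CocycleIso.ofCoordChangeEq` is a holomorphic isomorphism.
[folklore] -/
theorem CocycleIso.ofCoordChangeEq_isHolomorphic {V₁ V₂ : SmoothComplexVectorBundle ι E M r}
    (hU : ∀ i, V₁.baseSet i = V₂.baseSet i)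
    (hg : ∀ i j, ∀ x ∈ V₁.baseSet i ∩ V₁.baseSet j, V₁.coordChange i j x = V₂.coordChange i j x)
    (h₂ : V₂.IsHolomorphic) : (CocycleIso.ofCoordChangeEq V₁ V₂ hU hg).IsHolomorphic := fun a i p q ↦ by
  rw [hU i, Set.inter_comm]
  exact h₂ a i p q

/-- Cocycles on the same cover with the same transition matrices on the overlaps are analytically
equivalent as soon as one of them is holomorphic. [folklore] -/
theorem analyticallyEquivalent_of_coordChange_eq {V₁ V₂ : SmoothComplexVectorBundle ι E M r}
    (hU : ∀ i, V₁.baseSet i = V₂.baseSet i)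
    (hg : ∀ i j, ∀ x ∈ V₁.baseSet i ∩ V₁.baseSet j, V₁.coordChange i j x = V₂.coordChange i j x)
    (h₂ : V₂.IsHolomorphic) : AnalyticallyEquivalent V₁ V₂ :=
  ⟨CocycleIso.ofCoordChangeEq V₁ V₂ hU hg, CocycleIso.ofCoordChangeEq_isHolomorphic hU hg h₂⟩

end Literature.Geometry.Kaehler.SmoothComplexVectorBundle

namespace Literature.AlgebraicGeometry.HodgeTheory

/-! ### `E^h ≅ 𝒪_X(D)^an` for `D = c.toCartierDivisor`, and the reduction of the named fact -/

section Reduction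

variable {X : SchemeOver ℂ} [IsIntegral X.left] {n : ℕ}
  {E : Type*} [NormedAddCommGroup E] [NormedSpace ℂ E] [FiniteDimensional ℂ E]
  {M : Type*} [TopologicalSpace M] [ChartedSpace E M] [IsManifold 𝓘(ℂ, E) ω M]
  [IsManifold 𝓘(ℝ, E) ∞ M]
  {φ : M → ComplexPoints X} (hφ : IsAnalytification E X n φ) (c : UnitCocycle X.left)

/-- **`E^h` and `𝒪_X(D)^an`, `D = c.toCartierDivisor`, have the same cover and the same transition
functions** (`transFun_toCartierDivisor` read at complex points). [cite: SerreGAGA1956, §3 n°9] -/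
theorem _root_.Literature.AlgebraicGeometry.Modules.UnitCocycle.analytification_coordChange_eq_cartierDivisorCocycle
    (x y : X.left) (m : M) :
    (c.analytification hφ).coordChange x y m = (cartierDivisorCocycle hφ c.toCartierDivisor).coordChange x y m := by
  ext a b
  rw [UnitCocycle.analytification_coordChange_apply, cartierDivisorCocycle_coordChange_apply,
    UnitCocycle.transFun_toCartierDivisor]
  rfl

/-- **`E^h` is holomorphically isomorphic to `𝒪_X(D)^an` for the Cartier divisor `D = c.toCartierDivisor`
of the unit cocycle** (the algebraic half of GAGA for line bundles: Görtz–Wedhorn I Prop. 11.21 read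
on the analytification). [cite: GortzWedhorn2020, Prop. 11.21 (p. 374)] [cite: SerreGAGA1956, §3 n°9] -/
theorem _root_.Literature.AlgebraicGeometry.Modules.UnitCocycle.analyticallyEquivalent_cartierDivisorCocycle :
    AnalyticallyEquivalent (c.analytification hφ) (cartierDivisorCocycle hφ c.toCartierDivisor) :=
  analyticallyEquivalent_of_coordChange_eq (fun _ ↦ rfl)
    (fun x y m _ ↦ c.analytification_coordChange_eq_cartierDivisorCocycle hφ x y m)
    (cartierDivisorCocycle_isHolomorphic hφ _)

/-- **`𝒪_X(D)^an` reindexed by points has the transition functions of `(D.toUnitCocycle)^h`.**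
[cite: SerreGAGA1956, §3 n°9] -/
theorem cartierDivisorCocycle_reindex_coordChange_eq (D : CartierDivisor X.left) (x y : X.left) {m : M}
    (hm : m ∈ ((cartierDivisorCocycle hφ D).reindex D.chartIdx fun m ↦ ⟨(φ m).pt, D.mem_U_chartIdx _⟩).baseSet x ∩
      ((cartierDivisorCocycle hφ D).reindex D.chartIdx fun m ↦ ⟨(φ m).pt, D.mem_U_chartIdx _⟩).baseSet y) :
    ((cartierDivisorCocycle hφ D).reindex D.chartIdx fun m ↦ ⟨(φ m).pt, D.mem_U_chartIdx _⟩).coordChange x y m =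
      (D.toUnitCocycle.analytification hφ).coordChange x y m := by
  ext a b
  rw [reindex_coordChange, cartierDivisorCocycle_coordChange_apply,
    UnitCocycle.analytification_coordChange_apply, CartierDivisor.toUnitCocycle_gInf]
  exact (evalOrZero_map_homOfLE (le_refl (D.U (D.chartIdx x) ⊓ D.U (D.chartIdx y))) (D.transFun (D.chartIdx x) (D.chartIdx y))
    (show (φ m).pt ∈ D.U (D.chartIdx x) ⊓ D.U (D.chartIdx y) from hm)).symm

/-- **`𝒪_X(D)^an` is holomorphically isomorphic to the analytification `(D.toUnitCocycle)^h` of its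
unit cocycle** (reindex the cover by points, `IsHolomorphic.analyticallyEquivalent_reindex`, then compare
transition functions). [cite: SerreGAGA1956, §3 n°9] [cite: GortzWedhorn2020, Prop. 11.21 (p. 374)] -/
theorem analyticallyEquivalent_cartierDivisorCocycle_toUnitCocycle (D : CartierDivisor X.left) :
    AnalyticallyEquivalent (cartierDivisorCocycle hφ D) (D.toUnitCocycle.analytification hφ) :=
  ((cartierDivisorCocycle_isHolomorphic hφ D).analyticallyEquivalent_reindex D.chartIdx
      fun m ↦ ⟨(φ m).pt, D.mem_U_chartIdx _⟩).trans
    (analyticallyEquivalent_of_coordChange_eq (fun _ ↦ rfl)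
      (fun x y _ hm ↦ cartierDivisorCocycle_reindex_coordChange_eq hφ D x y hm)
      (D.toUnitCocycle.analytification_isHolomorphic hφ))

end Reduction

/-- **GAGA for line bundles from Serre's Prop. 18 alone.** Hypothesis `h18` is GAGA n° 20 Prop. 18 for
`r = 1`, surjectivity half, in the tree's cocycle vocabulary: on a Hodge model `A` of a smooth projective
`X/ℂ`, every holomorphic rank-one cocycle `V` is analytically equivalent (`AnalyticallyEquivalent`:
a holomorphic `CocycleIso`, Fritzsche–Grauert IV §2 (C)) to the analytification `E^h`
(`UnitCocycle.analytification`) of an ALGEBRAIC line bundle `E`, i.e. of a Čech cocycle of units of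
`𝒪_X` on a Zariski cover (`Modules.UnitCocycle`). Conclusion: the named fact
`serreGAGA_lineCocycle_iso_cartierDivisorCocycle` — by `Pic X = CaCl X` for the integral `X`
(`UnitCocycle.analyticallyEquivalent_cartierDivisorCocycle`, Görtz–Wedhorn I Prop. 11.21) and
transitivity of analytic equivalence. [cite: SerreGAGA1956, n° 20 Prop. 18]
[cite: GortzWedhorn2020, Prop. 11.21 (p. 374)] -/
theorem serreGAGA_lineCocycle_iso_cartierDivisorCocycle_of_prop18
    (h18 : ∀ ⦃n : ℕ⦄ ⦃X : SchemeOver ℂ⦄, IsSmoothProjective n X → ∀ (A : HodgeModel n X) (ι : Type)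
      (V : SmoothComplexVectorBundle ι A.model A.carrier 1), V.IsHolomorphic →
      ∃ c : UnitCocycle X.left, AnalyticallyEquivalent V (c.analytification A.isAnalytification)) :
    serreGAGA_lineCocycle_iso_cartierDivisorCocycle := by
  intro n X hX A ι V hV
  letI : IsIntegral X.left := IsSmoothProjective.isIntegral_holds hX
  obtain ⟨c, hc⟩ := h18 hX A ι V hV
  obtain ⟨Φ, hΦ⟩ := hc.trans (c.analyticallyEquivalent_cartierDivisorCocycle A.isAnalytification)
  exact ⟨c.toCartierDivisor, Φ, hΦ⟩


/-- **Conversely, the named fact gives back Serre's Prop. 18 (`r = 1`, surjectivity) in cocycle form**: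
`𝒪_X(D)^an` is the analytification of the unit cocycle of `D` (`CaCl X → Pic X`). Together with
`serreGAGA_lineCocycle_iso_cartierDivisorCocycle_of_prop18` this certifies that the named fact is
EXACTLY Prop. 18 (`r = 1`, surjective half) modulo the proved `Pic X = CaCl X`.
[cite: SerreGAGA1956, n° 20 Prop. 18] [cite: GortzWedhorn2020, Prop. 11.21 (p. 374)] -/
theorem prop18_of_serreGAGA_lineCocycle_iso_cartierDivisorCocycle
    (h : serreGAGA_lineCocycle_iso_cartierDivisorCocycle) ⦃n : ℕ⦄ ⦃X : SchemeOver ℂ⦄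
    (hX : IsSmoothProjective n X) (A : HodgeModel n X) (ι : Type)
    (V : SmoothComplexVectorBundle ι A.model A.carrier 1) (hV : V.IsHolomorphic) :
    ∃ c : UnitCocycle X.left, AnalyticallyEquivalent V (c.analytification A.isAnalytification) := by
  letI : IsIntegral X.left := IsSmoothProjective.isIntegral_holds hX
  obtain ⟨D, Φ, hΦ⟩ := h hX A ι V hV
  have hV' : AnalyticallyEquivalent V (cartierDivisorCocycle A.isAnalytification D) := ⟨Φ, hΦ⟩
  exact ⟨D.toUnitCocycle,
    hV'.trans (analyticallyEquivalent_cartierDivisorCocycle_toUnitCocycle A.isAnalytification D)⟩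

/-- **The named fact ⟺ Serre's Prop. 18 (`r = 1`, surjectivity) in cocycle form.**
[cite: SerreGAGA1956, n° 20 Prop. 18] [cite: GortzWedhorn2020, Prop. 11.21 (p. 374)] -/
theorem serreGAGA_lineCocycle_iso_cartierDivisorCocycle_iff_prop18 :
    serreGAGA_lineCocycle_iso_cartierDivisorCocycle ↔
      ∀ ⦃n : ℕ⦄ ⦃X : SchemeOver ℂ⦄, IsSmoothProjective n X → ∀ (A : HodgeModel n X) (ι : Type)
        (V : SmoothComplexVectorBundle ι A.model A.carrier 1), V.IsHolomorphic →
        ∃ c : UnitCocycle X.left, AnalyticallyEquivalent V (c.analytification A.isAnalytification) :=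
  ⟨fun h _ _ hX ↦ prop18_of_serreGAGA_lineCocycle_iso_cartierDivisorCocycle h hX,
    serreGAGA_lineCocycle_iso_cartierDivisorCocycle_of_prop18⟩

end Literature.AlgebraicGeometry.HodgeTheory
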